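import Summits.ABC.IUTFork.Repair.RHLinearReachLaw
import Literature.IUT.LogVolume.UnitLogInnerRadiusTieRootsOfUnity
import Literature.IUT.LogVolume.UnitLogInnerRadiusTieNoRoots
import Literature.IUT.LogVolume.UnitLogInnerRadiusDeepTie
import Literature.IUT.LogVolume.UnitLogInnerRadiusTieTorsionObstruction
import Literature.IUT.LogVolume.UnitLogInnerRadiusTieTorsionWitness
import Literature.IUT.LogVolume.UnitLogBallVolumeCriterion
import HarnessLib

/-!
# D-0079 RESCUE sub-cell R-H (rows 15 / 20 / 27): the INNER CONDUCTOR of `log_p(𝒪_{K_w}^×)` AT A TIE PLACE `(p−1) ∣ e_w`,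
# and the register «15R» (donor `n₀ = ⌊e_w/(p−1)⌋ + 1`) DECIDED there

PROOF-ONLY wiring file (0 definitions, 0 `Prop` facts; seat abc-iut-rh-typ-12 gen 4, row-15 hand; rung LADDER-ABC:A2.RESCUE.H).

WHY. Row 15 «slotreach» (`Repair.RHSlotReach.SlotReachWindowK`, this seat) takes the inner certificate `n₀(x)` as DATA: the k2 door's binder
`hsharp` is «`∃ u, ‖u‖ ≤ ‖ϖ_x‖^{n₀(x) − 1} ∧ u ∉ log_p(𝒪_x^×)`». Two registers are tabulated (rh2-q3-num 00:18:55Z, rh2-tab-1 00:17:53Z, RULING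
R15 of abc-iut-rh-lead g2 00:14:47Z): **S** (`n₀ = 1`, of record, certified everywhere by `RHSlotReach.exists_hsharp_one`) and **15R**
(`n₀ = r_in_ub = ⌊e_w/(p−1)⌋ + 1`, the round-1 recipe). 15R was certified OFF the ties `(p−1) ∤ e_w` only (rh-typ-7's
`RH.LinearReachLaw.isInnerConductor_of_not_dvd`; 81 of the 167 place×l rows where the registers differ), and «UNCERTIFIED today» at the 86 rows with
`(p−1) ∣ e_w` (frey 67 at `p ∈ {3, 7, 11, 31}`-ties of the `e_v ∈ {6, 10, 30, 60}` towers · hex-v2 8 · lamSeven 7 · HEX-strip 4). Rows 20 / 27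
(`RHLinearReachLawExact`, `RHReachLedger*`) read the same integer `c_w` (inner conductor) and have it exact only off the ties.

WHAT THIS FILE DOES (all over ONE proper ultrametric `ℚ_p`-field `K` = any completion `K_w`, `p` ODD, norm uniformizer `ϖ`; the number theory is
the tree's, BY NAME — abc-iut-c312-3 / s2-p12 / w5-d039 lineage `Literature.IUT.LogVolume.LogEnvelope.*` (`UnitLogInnerRadiusTie*`,
`UnitLogInnerRadiusDeepTie*`), Neukirch II (5.5)–(5.7), Serre XIV §4):
* §0 GLUE. `isInnerConductor_of_subset_of_not_subset_pred`: the Literature «R-W format» pair (`𝔪^r ⊆ Λ`, `𝔪^{r−1} ⊄ Λ`) IS rh-typ-7's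
  `IsInnerConductor K ϖ r`. **`exists_inner_certificate_iff_le`: the `hsharp` certificate at `n₀ ≥ 1` holds IFF `n₀ ≤ c`** (`c` the inner
  conductor) — so «which register is licensed at `w`» is the single integer question `n₀ ≤ c_w`.
* §1 EVERY ODD PLACE. `isInnerConductor_tie_cases`: at a tie `e = A·(p−1)`, `c ∈ {A, A+1}` (`innerRadius_tie_bracket`);
  **`exists_inner_certificate_div`: the register «15M» `n₀ = ⌊e/(p−1)⌋` is certified at EVERY odd place, every `K`** (one donor level above S
  whenever `e ≥ 2(p−1)`, and equal to 15R minus one); `exists_inner_certificate_rInUb_of_not_dvd`: 15R certified off the ties.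
* §2 TIE WITHOUT `ζ_p` (`μ_p(K_w) = 1`, i.e. the R-W torsion column `m_w = torsionPExp = 0`; ANY `A`, `p ∣ A` allowed):
  **`isInnerConductor_tie_of_torsionPExp_eq_zero`: `c = A = e/(p−1)`**, hence **`not_exists_inner_certificate_rInUb_of_torsionPExp_eq_zero`:
  the 15R certificate is FALSE there** — its donor at level `⌊e/(p−1)⌋` is a phantom (`𝔪^A ⊆ Λ`); 15M = the exact register.
* §3 TIE WITH `ζ_p ∈ K_w` (`m_w ≥ 1`): **`isInnerConductor_tie_succ_of_not_pow_torsionPExp_dvd`: `p^{m_w} ∤ A ⇒ c = A + 1`** (in particular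
  `p ∤ A`: `isInnerConductor_tie_succ_of_pow_prime_eq_one`) **⇒ 15R certified** (`exists_inner_certificate_rInUb_of_not_pow_torsionPExp_dvd`);
  and at the DEEP ties `p^{m_w} ∣ A` the one remaining bit is ONE CONGRUENCE on any primitive `p^{m_w}`-th root of unity `ξ`:
  **`isInnerConductor_tie_iff_generator` / `exists_inner_certificate_rInUb_iff_generator`: `c = A` (15R phantom) iff `‖u^p − ξ‖ ≤ ‖p‖·‖ϖ‖^A`
  is solvable in `K_w`; `c = A+1` (15R certified) iff it is not** (classically: iff `K_w(μ_{p^{m+1}})/K_w` is NOT unramified of degree `p`).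
  Conversely `c = A + 1 ⇒ ζ_p ∈ K_w` (`one_le_torsionPExp_of_isInnerConductor_tie_succ`).

COLUMN RECIPE for the numerics seats (rh-num-1 / rh2-q3-num / rh2-tab-*; columns `e_w`, `m_w` of WINDOW-TABLE, `p` odd): 15R's extra label at
`w` is LICENSED iff `c_w = ⌊e_w/(p−1)⌋ + 1` iff [`(p−1) ∤ e_w`] ∨ [`m_w ≥ 1` ∧ `p^{m_w} ∤ e_w/(p−1)`] ∨ [`m_w ≥ 1` ∧ `p^{m_w} ∣ e_w/(p−1)` ∧ the
generator congruence is insoluble]; it is a PHANTOM (use 15M = 15R − 1 level) iff [`(p−1) ∣ e_w` ∧ `m_w = 0`] ∨ [the congruence is soluble].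
So `(e_w, m_w)` decide every tie row except `m_w ≥ 1 ∧ p^{m_w} ∣ e_w/(p−1)` (at `p = 3`: `e_w ∈ {6, 30, 60}` with `ζ_3 ∈ K_w`), which need
the one congruence (kit). HONEST FRAMING: pure local algebra about `log_p(𝒪^×)`; every R-H candidate remains a HYPOTHESIS; nothing here
asserts abc proved or refuted; no side is taken on [IUTchIII] Cor. 3.12 or on any author; typed ≠ proved; certified ≠ endorsed.
-/

noncomputable section

open Set Metric

namespace Summit.ABC.IUTFork.Repair.RH.InnerConductorTie

open Literature.IUT.LogVolume Literature.IUT.LogVolume.LogEnvelope Literature.NumberTheory.GaloisRepresentations.Ultrametric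
  Summit.ABC.IUTFork.Repair.RH.LinearReachLaw

variable (p : ℕ) [hp : Fact p.Prime]
variable {K : Type*} [NontriviallyNormedField K] [instK : NormedAlgebra ℚ_[p] K] [IsUltrametricDist K] [ProperSpace K]

/-! ## §0. Glue: the R-W pair format is the inner conductor; the inner certificate at `n₀` holds iff `n₀ ≤ c` -/

omit hp instK [IsUltrametricDist K] [ProperSpace K] in
/-- **R-W format ⇒ inner conductor**: if `{‖z‖ ≤ ‖ϖ‖^r} ⊆ log_p(𝒪_K^×)` and `{‖z‖ ≤ ‖ϖ‖^{r−1}} ⊄ log_p(𝒪_K^×)` (`‖ϖ‖ ≤ 1`), then `r` is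
THE inner conductor (balls of smaller exponent are larger). [cite: NeukirchANT1999, Ch. II (5.5)] -/
theorem isInnerConductor_of_subset_of_not_subset_pred {ϖ : Kˣ} (hϖ1 : ‖(ϖ : K)‖ ≤ 1) {r : ℕ}
    (hsub : closedBall (0 : K) (‖(ϖ : K)‖ ^ r) ⊆ logUnits K)
    (hnot : ¬ closedBall (0 : K) (‖(ϖ : K)‖ ^ (r - 1)) ⊆ logUnits K) : IsInnerConductor K ϖ r := by
  refine ⟨hsub, fun c' hc' => ?_⟩
  by_contra hlt
  refine hnot (Subset.trans (closedBall_subset_closedBall ?_) hc')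
  exact pow_le_pow_of_le_one (norm_nonneg _) hϖ1 (by omega)

omit hp instK [IsUltrametricDist K] [ProperSpace K] in
/-- **THE INNER CERTIFICATE AT `n₀` HOLDS IFF `n₀ ≤ c`** (`c` the inner conductor, `n₀ ≥ 1`, `‖ϖ‖ ≤ 1`): the k2 door's `hsharp` binder
«`∃ u, ‖u‖ ≤ ‖ϖ‖^{n₀ − 1} ∧ u ∉ log_p(𝒪_K^×)`» (row 15's donor datum `n₀(x)`, `RHSlotReach.SlotReachWindowK`) is exactly the statement that the
ball one step below `n₀` is not inside the lattice, i.e. `n₀ − 1 < c`. So a register with donor `n₀` is licensed at a place iff `n₀ ≤ c_w`.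
[cite: NeukirchANT1999, Ch. II (5.5)] -/
theorem exists_inner_certificate_iff_le {ϖ : Kˣ} (hϖ1 : ‖(ϖ : K)‖ ≤ 1) {c : ℕ} (hc : IsInnerConductor K ϖ c) {n₀ : ℕ}
    (hn₀ : 1 ≤ n₀) :
    (∃ u : K, ‖u‖ ≤ ‖(ϖ : K)‖ ^ ((n₀ : ℤ) - 1) ∧ u ∉ logUnits K) ↔ n₀ ≤ c := by
  rw [show ((n₀ : ℤ) - 1) = ((n₀ - 1 : ℕ) : ℤ) by rw [Nat.cast_sub hn₀, Nat.cast_one], zpow_natCast]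
  constructor
  · rintro ⟨u, hu, huΛ⟩
    by_contra hlt
    have hsub : closedBall (0 : K) (‖(ϖ : K)‖ ^ (n₀ - 1)) ⊆ logUnits K :=
      Subset.trans (closedBall_subset_closedBall (pow_le_pow_of_le_one (norm_nonneg _) hϖ1 (by omega))) hc.1
    exact huΛ (hsub (mem_closedBall_zero_iff.2 hu))
  · intro hle
    have hnot : ¬ closedBall (0 : K) (‖(ϖ : K)‖ ^ (n₀ - 1)) ⊆ logUnits K := fun h => by
      have := hc.2 _ h
      omega
    obtain ⟨u, hu, huΛ⟩ := Set.not_subset.1 hnot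
    exact ⟨u, mem_closedBall_zero_iff.1 hu, huΛ⟩

/-! ## §1. Every odd place: the tie bracket as a conductor alternative; register «15M» universally certified; 15R off the ties -/

/-- **At a tie `e = A·(p−1)` (`p` odd, ANY `A`, ANY `K`) the inner conductor is `A` or `A + 1`** (`LogEnvelope.innerRadius_tie_bracket`:
`𝔪^{A+1} ⊆ Λ`, `𝔪^{A−1} ⊄ Λ`). [cite: NeukirchANT1999, Ch. II Prop. (5.5)–(5.7)] -/
theorem isInnerConductor_tie_cases {ϖ : Kˣ} (hϖ : IsUniformizer ϖ) {A : ℕ} (hA : absRamificationIdx p K = A * (p - 1))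
    (hp2 : p ≠ 2) : IsInnerConductor K ϖ A ∨ IsInnerConductor K ϖ (A + 1) := by
  obtain ⟨hsucc, hpred⟩ := innerRadius_tie_bracket p hϖ hA hp2
  by_cases hmid : closedBall (0 : K) (‖(ϖ : K)‖ ^ A) ⊆ logUnits K
  · exact Or.inl (isInnerConductor_of_subset_of_not_subset_pred hϖ.1.le hmid hpred)
  · exact Or.inr (isInnerConductor_of_subset_of_not_subset_pred hϖ.1.le hsucc (by rwa [Nat.add_sub_cancel]))

/-- **`c = A` at a tie iff the critical ball `𝔪^A` lies in the lattice.** [cite: NeukirchANT1999, Ch. II Prop. (5.5)–(5.7)] -/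
theorem isInnerConductor_tie_iff_subset {ϖ : Kˣ} (hϖ : IsUniformizer ϖ) {A : ℕ} (hA : absRamificationIdx p K = A * (p - 1))
    (hp2 : p ≠ 2) : IsInnerConductor K ϖ A ↔ closedBall (0 : K) (‖(ϖ : K)‖ ^ A) ⊆ logUnits K :=
  ⟨fun h => h.1, fun h => isInnerConductor_of_subset_of_not_subset_pred hϖ.1.le h (innerRadius_tie_bracket p hϖ hA hp2).2⟩

/-- **`c = A + 1` at a tie iff the critical ball `𝔪^A` does NOT lie in the lattice.** [cite: NeukirchANT1999, Ch. II Prop. (5.5)–(5.7)] -/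
theorem isInnerConductor_tie_succ_iff_not_subset {ϖ : Kˣ} (hϖ : IsUniformizer ϖ) {A : ℕ}
    (hA : absRamificationIdx p K = A * (p - 1)) (hp2 : p ≠ 2) :
    IsInnerConductor K ϖ (A + 1) ↔ ¬ closedBall (0 : K) (‖(ϖ : K)‖ ^ A) ⊆ logUnits K := by
  constructor
  · intro h hsub
    have := h.2 A hsub
    omega
  · intro h
    exact isInnerConductor_of_subset_of_not_subset_pred hϖ.1.le (innerRadius_tie_bracket p hϖ hA hp2).1
      (by rwa [Nat.add_sub_cancel])

include hp instK in
/-- **Register «15M» (`n₀ = ⌊e/(p−1)⌋`) is certified at EVERY odd place, for EVERY `K`**: some `u ∉ log_p(𝒪_K^×)` has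
`‖u‖ ≤ ‖ϖ‖^{⌊e/(p−1)⌋ − 1}` (`LogEnvelope.not_closedBall_div_pred_subset_logUnits`: `r_in ≥ ⌊e/(p−1)⌋` with no hypothesis on `K`). This
register sits one donor level below 15R and is theorem-grade everywhere; at a tie without `ζ_p` it IS the exact register (§2).
[cite: NeukirchANT1999, Ch. II Prop. (5.5)–(5.7)] -/
theorem exists_inner_certificate_div {ϖ : Kˣ} (hϖ : IsUniformizer ϖ) (hp2 : p ≠ 2) :
    ∃ u : K, ‖u‖ ≤ ‖(ϖ : K)‖ ^ (((absRamificationIdx p K / (p - 1) : ℕ) : ℤ) - 1) ∧ u ∉ logUnits K := by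
  obtain ⟨u, hu, huΛ⟩ := Set.not_subset.1 (not_closedBall_div_pred_subset_logUnits p hϖ hp2)
  rw [mem_closedBall_zero_iff] at hu
  refine ⟨u, hu.trans ?_, huΛ⟩
  rw [← zpow_natCast]
  exact zpow_le_zpow_right_of_le_one₀ (norm_units_pos ϖ) hϖ.1.le (by omega)

include hp instK in
/-- **15R (`n₀ = ⌊e/(p−1)⌋ + 1`) is certified OFF the ties `(p−1) ∤ e`** (rh-typ-7's `isInnerConductor_of_not_dvd` read through §0): the 81
place×l rows of rh2-tab-1's split at `(p−1) ∤ e_w`. [cite: NeukirchANT1999, Ch. II (5.5)] -/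
theorem exists_inner_certificate_rInUb_of_not_dvd {ϖ : Kˣ} (hϖ : IsUniformizer ϖ) (hnd : ¬ (p - 1 ∣ absRamificationIdx p K)) :
    ∃ u : K, ‖u‖ ≤ ‖(ϖ : K)‖ ^ (((absRamificationIdx p K / (p - 1) + 1 : ℕ) : ℤ) - 1) ∧ u ∉ logUnits K := by
  rw [exists_inner_certificate_iff_le hϖ.1.le (isInnerConductor_of_not_dvd p hϖ hnd) (Nat.le_add_left 1 _)]

/-! ## §2. Tie place WITHOUT `ζ_p` (`m_w = 0`): `c = A`; 15R's donor is a phantom -/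

/-- **`ζ_p ∉ K` ⇒ `c = A = e/(p−1)`** at a tie `e = A·(p−1)` (`p` odd, ANY `A`): the critical ball is full
(`LogEnvelope.innerRadius_tie_of_forall_pow_prime_eq_one'`). [cite: NeukirchANT1999, Ch. II Prop. (5.5)–(5.7)] [cite: Washington1997, §5.1] -/
theorem isInnerConductor_tie_of_forall_pow_prime_eq_one {ϖ : Kˣ} (hϖ : IsUniformizer ϖ) {A : ℕ}
    (hA : absRamificationIdx p K = A * (p - 1)) (hp2 : p ≠ 2) (hμ : ∀ ζ : K, ζ ^ p = 1 → ζ = 1) :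
    IsInnerConductor K ϖ A :=
  isInnerConductor_of_subset_of_not_subset_pred hϖ.1.le (innerRadius_tie_of_forall_pow_prime_eq_one' p hϖ hA hp2 hμ).1
    (innerRadius_tie_of_forall_pow_prime_eq_one' p hϖ hA hp2 hμ).2

/-- **`m_w = 0` ⇒ `c = A`** — the same keyed by the R-W torsion column `m = torsionPExp p K` (`m = 0 ⟺ μ_p(K) = 1`,
`forall_pow_prime_eq_one_of_torsionPExp_eq_zero`). [cite: NeukirchANT1999, Ch. II Prop. (5.7)] -/
theorem isInnerConductor_tie_of_torsionPExp_eq_zero {ϖ : Kˣ} (hϖ : IsUniformizer ϖ) {A : ℕ}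
    (hA : absRamificationIdx p K = A * (p - 1)) (hp2 : p ≠ 2) (hm : torsionPExp p K = 0) : IsInnerConductor K ϖ A :=
  isInnerConductor_tie_of_forall_pow_prime_eq_one p hϖ hA hp2 (forall_pow_prime_eq_one_of_torsionPExp_eq_zero p K hm)

/-- **15R REFUTED at a tie without `ζ_p`**: NO `u ∉ log_p(𝒪_K^×)` has `‖u‖ ≤ ‖ϖ‖^{⌊e/(p−1)⌋}` — the round-1 donor «`A = r_in_ub` inside the
floor» does not exist at such a place (its cell credit is unlicensed; the exact register there is 15M, `n₀ = ⌊e/(p−1)⌋`).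
[cite: NeukirchANT1999, Ch. II Prop. (5.5)–(5.7)] -/
theorem not_exists_inner_certificate_rInUb_of_forall_pow_prime_eq_one {ϖ : Kˣ} (hϖ : IsUniformizer ϖ) {A : ℕ}
    (hA : absRamificationIdx p K = A * (p - 1)) (hp2 : p ≠ 2) (hμ : ∀ ζ : K, ζ ^ p = 1 → ζ = 1) :
    ¬ ∃ u : K, ‖u‖ ≤ ‖(ϖ : K)‖ ^ (((absRamificationIdx p K / (p - 1) + 1 : ℕ) : ℤ) - 1) ∧ u ∉ logUnits K := by
  rw [exists_inner_certificate_iff_le hϖ.1.le (isInnerConductor_tie_of_forall_pow_prime_eq_one p hϖ hA hp2 hμ) (Nat.le_add_left 1 _),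
    div_eq_level p hA]
  omega

/-- **15R REFUTED at a tie with `m_w = 0`** (column form of the previous theorem). [cite: NeukirchANT1999, Ch. II Prop. (5.5)–(5.7)] -/
theorem not_exists_inner_certificate_rInUb_of_torsionPExp_eq_zero {ϖ : Kˣ} (hϖ : IsUniformizer ϖ) {A : ℕ}
    (hA : absRamificationIdx p K = A * (p - 1)) (hp2 : p ≠ 2) (hm : torsionPExp p K = 0) :
    ¬ ∃ u : K, ‖u‖ ≤ ‖(ϖ : K)‖ ^ (((absRamificationIdx p K / (p - 1) + 1 : ℕ) : ℤ) - 1) ∧ u ∉ logUnits K :=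
  not_exists_inner_certificate_rInUb_of_forall_pow_prime_eq_one p hϖ hA hp2
    (forall_pow_prime_eq_one_of_torsionPExp_eq_zero p K hm)

/-- **Conversely `c = A + 1` at a tie forces `ζ_p ∈ K`** (contrapositive of `isInnerConductor_tie_of_forall_pow_prime_eq_one` +
uniqueness of the conductor). [cite: NeukirchANT1999, Ch. II Prop. (5.5)–(5.7)] -/
theorem exists_pow_prime_eq_one_ne_one_of_isInnerConductor_tie_succ {ϖ : Kˣ} (hϖ : IsUniformizer ϖ) {A : ℕ}
    (hA : absRamificationIdx p K = A * (p - 1)) (hp2 : p ≠ 2) (h : IsInnerConductor K ϖ (A + 1)) :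
    ∃ ζ : K, ζ ^ p = 1 ∧ ζ ≠ 1 := by
  by_contra hμ
  push Not at hμ
  have h' := isInnerConductor_tie_of_forall_pow_prime_eq_one p hϖ hA hp2 hμ
  have := isInnerConductor_unique h' h
  omega

/-- **`c = A + 1` at a tie forces `m_w ≥ 1`** (column form). [cite: NeukirchANT1999, Ch. II Prop. (5.7)] -/
theorem one_le_torsionPExp_of_isInnerConductor_tie_succ {ϖ : Kˣ} (hϖ : IsUniformizer ϖ) {A : ℕ}
    (hA : absRamificationIdx p K = A * (p - 1)) (hp2 : p ≠ 2) (h : IsInnerConductor K ϖ (A + 1)) :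
    1 ≤ torsionPExp p K := by
  by_contra hm
  have h' := isInnerConductor_tie_of_torsionPExp_eq_zero p hϖ hA hp2 (by omega)
  have := isInnerConductor_unique h' h
  omega

/-! ## §3. Tie place WITH `ζ_p ∈ K` (`m_w ≥ 1`): `c = A + 1` unless a torsion witness / generator congruence; 15R decided -/

/-- **`ζ_p ∈ K`, `p ∤ A` ⇒ `c = A + 1 = e/(p−1) + 1`** (`LogEnvelope.innerRadius_tie_of_pow_prime_eq_one`).
[cite: NeukirchANT1999, Ch. II Prop. (5.5)–(5.7)] -/
theorem isInnerConductor_tie_succ_of_pow_prime_eq_one {ϖ : Kˣ} (hϖ : IsUniformizer ϖ) {A : ℕ}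
    (hA : absRamificationIdx p K = A * (p - 1)) (hp2 : p ≠ 2) (hpA : ¬ p ∣ A) {ζ : K} (hζ : ζ ^ p = 1) (hζ1 : ζ ≠ 1) :
    IsInnerConductor K ϖ (A + 1) :=
  (isInnerConductor_tie_succ_iff_not_subset p hϖ hA hp2).2 (innerRadius_tie_of_pow_prime_eq_one p hϖ hA hp2 hpA hζ hζ1).2

/-- **`m_w ≥ 1`, `p^{m_w} ∤ A` ⇒ `c = A + 1`** (`LogEnvelope.innerRadius_tie_succ_of_not_pow_torsionPExp_dvd`: decided by the two integers
`(e_w, m_w)`, no search). [cite: SerreLocalFields1979, Ch. XIV §4] [cite: NeukirchANT1999, Ch. II Prop. (5.5)–(5.7)] -/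
theorem isInnerConductor_tie_succ_of_not_pow_torsionPExp_dvd {ϖ : Kˣ} (hϖ : IsUniformizer ϖ) {A : ℕ}
    (hA : absRamificationIdx p K = A * (p - 1)) (hp2 : p ≠ 2) (hm : 1 ≤ torsionPExp p K) (hdvd : ¬ p ^ torsionPExp p K ∣ A) :
    IsInnerConductor K ϖ (A + 1) :=
  (isInnerConductor_tie_succ_iff_not_subset p hϖ hA hp2).2 (innerRadius_tie_succ_of_not_pow_torsionPExp_dvd p hϖ hA hp2 hm hdvd).2

/-- **A torsion witness ⇒ `c = A`** (`ζ'` a root of unity of `K`, not a `p`-th power in `K`, with `‖u^p − ζ'‖ ≤ ‖p‖·‖ϖ‖^A`;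
`LogEnvelope.innerRadius_tie_of_exists_torsionWitness`). [cite: SerreLocalFields1979, Ch. XIV §4] -/
theorem isInnerConductor_tie_of_exists_torsionWitness {ϖ : Kˣ} (hϖ : IsUniformizer ϖ) {A : ℕ}
    (hA : absRamificationIdx p K = A * (p - 1)) (hp2 : p ≠ 2)
    (hex : ∃ ζ' u : K, (∃ n : ℕ, 0 < n ∧ ζ' ^ n = 1) ∧ (∀ η : K, η ^ p ≠ ζ') ∧ ‖u ^ p - ζ'‖ ≤ ‖(p : K)‖ * ‖(ϖ : K)‖ ^ A) :
    IsInnerConductor K ϖ A :=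
  (isInnerConductor_tie_iff_subset p hϖ hA hp2).2 (innerRadius_tie_of_exists_torsionWitness p hϖ hA hp2 hex).1

/-- **`ζ_p ∈ K` and NO torsion witness ⇒ `c = A + 1`** (`LogEnvelope.innerRadius_tie_succ_of_forall_not_torsionWitness`).
[cite: SerreLocalFields1979, Ch. XIV §4] [cite: NeukirchANT1999, Ch. II Prop. (5.5)–(5.7)] -/
theorem isInnerConductor_tie_succ_of_forall_not_torsionWitness {ϖ : Kˣ} (hϖ : IsUniformizer ϖ) {A : ℕ}
    (hA : absRamificationIdx p K = A * (p - 1)) (hp2 : p ≠ 2) {ζ : K} (hζ : ζ ^ p = 1) (hζ1 : ζ ≠ 1)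
    (hno : ∀ ζ' u : K, (∃ n : ℕ, 0 < n ∧ ζ' ^ n = 1) → (∀ η : K, η ^ p ≠ ζ') → ‖(p : K)‖ * ‖(ϖ : K)‖ ^ A < ‖u ^ p - ζ'‖) :
    IsInnerConductor K ϖ (A + 1) :=
  (isInnerConductor_tie_succ_iff_not_subset p hϖ hA hp2).2
    (innerRadius_tie_succ_of_forall_not_torsionWitness p hϖ hA hp2 hζ hζ1 hno).2

/-- **THE DEEP-TIE BIT AS ONE CONGRUENCE** (`p` odd, `e = A·(p−1)`, `m = torsionPExp p K ≥ 1`, `ξ` ANY primitive `p^m`-th root of unity of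
`K` — one exists, `exists_isPrimitiveRoot_pow_torsionPExp`): **`c = A` iff `‖u^p − ξ‖ ≤ ‖p‖·‖ϖ‖^A` is solvable in `K`**
(`LogEnvelope.closedBall_level_subset_logUnits_iff_torsionPExp`). [cite: SerreLocalFields1979, Ch. XIV §4] -/
theorem isInnerConductor_tie_iff_generator {ϖ : Kˣ} (hϖ : IsUniformizer ϖ) {A : ℕ} (hA : absRamificationIdx p K = A * (p - 1))
    (hp2 : p ≠ 2) (hm : 1 ≤ torsionPExp p K) {ξ : K} (hξ : IsPrimitiveRoot ξ (p ^ torsionPExp p K)) :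
    IsInnerConductor K ϖ A ↔ ∃ u : K, ‖u ^ p - ξ‖ ≤ ‖(p : K)‖ * ‖(ϖ : K)‖ ^ A := by
  rw [isInnerConductor_tie_iff_subset p hϖ hA hp2, closedBall_level_subset_logUnits_iff_torsionPExp p hϖ hA hp2 hm hξ]

/-- **… and `c = A + 1` iff that congruence is INSOLUBLE.** [cite: SerreLocalFields1979, Ch. XIV §4] -/
theorem isInnerConductor_tie_succ_iff_generator {ϖ : Kˣ} (hϖ : IsUniformizer ϖ) {A : ℕ}
    (hA : absRamificationIdx p K = A * (p - 1)) (hp2 : p ≠ 2) (hm : 1 ≤ torsionPExp p K) {ξ : K}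
    (hξ : IsPrimitiveRoot ξ (p ^ torsionPExp p K)) :
    IsInnerConductor K ϖ (A + 1) ↔ ∀ u : K, ‖(p : K)‖ * ‖(ϖ : K)‖ ^ A < ‖u ^ p - ξ‖ := by
  rw [isInnerConductor_tie_succ_iff_not_subset p hϖ hA hp2, closedBall_level_subset_logUnits_iff_torsionPExp p hϖ hA hp2 hm hξ]
  simp only [not_exists, not_le]

/-- **15R CERTIFIED at a tie with `ζ_p ∈ K`, `p ∤ A`**: some `u ∉ log_p(𝒪_K^×)` has `‖u‖ ≤ ‖ϖ‖^{⌊e/(p−1)⌋}` (the missed class of the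
residue polynomial; `LogEnvelope.exists_norm_eq_not_mem_logUnits_of_pow_prime_eq_one`). [cite: NeukirchANT1999, Ch. II Prop. (5.7)] -/
theorem exists_inner_certificate_rInUb_of_pow_prime_eq_one {ϖ : Kˣ} (hϖ : IsUniformizer ϖ) {A : ℕ}
    (hA : absRamificationIdx p K = A * (p - 1)) (hp2 : p ≠ 2) (hpA : ¬ p ∣ A) {ζ : K} (hζ : ζ ^ p = 1) (hζ1 : ζ ≠ 1) :
    ∃ u : K, ‖u‖ ≤ ‖(ϖ : K)‖ ^ (((absRamificationIdx p K / (p - 1) + 1 : ℕ) : ℤ) - 1) ∧ u ∉ logUnits K := by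
  rw [exists_inner_certificate_iff_le hϖ.1.le (isInnerConductor_tie_succ_of_pow_prime_eq_one p hϖ hA hp2 hpA hζ hζ1) (Nat.le_add_left 1 _),
    div_eq_level p hA]

/-- **15R CERTIFIED at a tie with `m_w ≥ 1` and `p^{m_w} ∤ e/(p−1)`** (column form; e.g. every tie with `p ∤ e/(p−1)` and `ζ_p ∈ K_w`).
[cite: SerreLocalFields1979, Ch. XIV §4] [cite: NeukirchANT1999, Ch. II Prop. (5.5)–(5.7)] -/
theorem exists_inner_certificate_rInUb_of_not_pow_torsionPExp_dvd {ϖ : Kˣ} (hϖ : IsUniformizer ϖ) {A : ℕ}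
    (hA : absRamificationIdx p K = A * (p - 1)) (hp2 : p ≠ 2) (hm : 1 ≤ torsionPExp p K) (hdvd : ¬ p ^ torsionPExp p K ∣ A) :
    ∃ u : K, ‖u‖ ≤ ‖(ϖ : K)‖ ^ (((absRamificationIdx p K / (p - 1) + 1 : ℕ) : ℤ) - 1) ∧ u ∉ logUnits K := by
  rw [exists_inner_certificate_iff_le hϖ.1.le (isInnerConductor_tie_succ_of_not_pow_torsionPExp_dvd p hϖ hA hp2 hm hdvd) (Nat.le_add_left 1 _),
    div_eq_level p hA]

/-- **15R AT A DEEP TIE, DECIDED BY THE CONGRUENCE** (`m_w ≥ 1`, `ξ` any primitive `p^{m_w}`-th root of unity): the certificate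
`∃ u ∉ log_p(𝒪_K^×), ‖u‖ ≤ ‖ϖ‖^{⌊e/(p−1)⌋}` holds iff `‖u^p − ξ‖ ≤ ‖p‖·‖ϖ‖^{e/(p−1)}` has NO solution in `K`.
[cite: SerreLocalFields1979, Ch. XIV §4] [cite: NeukirchANT1999, Ch. II Prop. (5.5)–(5.7)] -/
theorem exists_inner_certificate_rInUb_iff_generator {ϖ : Kˣ} (hϖ : IsUniformizer ϖ) {A : ℕ}
    (hA : absRamificationIdx p K = A * (p - 1)) (hp2 : p ≠ 2) (hm : 1 ≤ torsionPExp p K) {ξ : K}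
    (hξ : IsPrimitiveRoot ξ (p ^ torsionPExp p K)) :
    (∃ u : K, ‖u‖ ≤ ‖(ϖ : K)‖ ^ (((absRamificationIdx p K / (p - 1) + 1 : ℕ) : ℤ) - 1) ∧ u ∉ logUnits K) ↔
      ∀ u : K, ‖(p : K)‖ * ‖(ϖ : K)‖ ^ A < ‖u ^ p - ξ‖ := by
  rw [← isInnerConductor_tie_succ_iff_generator p hϖ hA hp2 hm hξ, div_eq_level p hA]
  rcases isInnerConductor_tie_cases p hϖ hA hp2 with h | h
  · rw [exists_inner_certificate_iff_le hϖ.1.le h (by omega)]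
    constructor
    · intro h'; omega
    · intro h'; have := isInnerConductor_unique h h'; omega
  · rw [exists_inner_certificate_iff_le hϖ.1.le h (by omega)]
    exact ⟨fun _ => h, fun _ => le_rfl⟩

/-- **SUMMARY AT A TIE: 15R certified ⟺ `c = A + 1`; 15R phantom ⟺ `c = A`** (and then 15M, `n₀ = A`, is the exact register).
[cite: NeukirchANT1999, Ch. II Prop. (5.5)–(5.7)] -/
theorem exists_inner_certificate_rInUb_iff_isInnerConductor_succ {ϖ : Kˣ} (hϖ : IsUniformizer ϖ) {A : ℕ}
    (hA : absRamificationIdx p K = A * (p - 1)) (hp2 : p ≠ 2) :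
    (∃ u : K, ‖u‖ ≤ ‖(ϖ : K)‖ ^ (((absRamificationIdx p K / (p - 1) + 1 : ℕ) : ℤ) - 1) ∧ u ∉ logUnits K) ↔
      IsInnerConductor K ϖ (A + 1) := by
  rw [div_eq_level p hA]
  rcases isInnerConductor_tie_cases p hϖ hA hp2 with h | h
  · rw [exists_inner_certificate_iff_le hϖ.1.le h (by omega)]
    constructor
    · intro h'; omega
    · intro h'; have := isInnerConductor_unique h h'; omega
  · rw [exists_inner_certificate_iff_le hϖ.1.le h (by omega)]
    exact ⟨fun _ => h, fun _ => le_rfl⟩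

end Summit.ABC.IUTFork.Repair.RH.InnerConductorTie

end
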